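import Literature.Probability.Percolation.SlabRSWGluingBystander
import Literature.Probability.Percolation.SlabCircuitSideCrossings
import HarnessLib

/-!
# Newman–Tassion–Wu 2017, Theorem 3.10 — the corner-gluing inequality for BOUNDED corner squares
# (finite energy)

Topic: `Literature/Probability/Percolation`. Fifteenth file of the port of THEOREM 3.10 of
Newman–Tassion–Wu, *Critical percolation and the minimal spanning tree in slabs* (CPAM 70 (2017);
arXiv:1512.09107, pp. 12–14). The capstone `NTW17.h310_of_cornerGlue` asks for the corner-gluing
inequalities `CornerGlue₁..₄ k N n p K` (`SlabCircuitSideCrossings.lean`) for EVERY width `n`, with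
`K` uniform in the hole size `N`. For bounded `n` no surgery is needed: opening every lattice edge
over the corner square turns a configuration of `cornerDom_i` (the minimal-path domain crossed
end-to-end and the corridor crossed) into one of `cornerLink_i` — the two crossings both visit the
corner square —, changes no edge determined elsewhere, and modifies at most `(5k+4)n²` edges, so
Lemma 3.5 with this FIXED window gives `CornerGlue_i k N n p (λ_p^{(5k+4)n²})`
(`cornerGlue₁_crude`, …, `cornerGlue₄_crude`; abstract form `real_cornerGlue_crude`). The unbounded
widths are the business of the located surgery (next files).

## Sources

* C. M. Newman, V. Tassion, W. Wu, *Critical percolation and the minimal spanning tree in slabs*,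
  Comm. Pure Appl. Math. 70 (2017), arXiv:1512.09107: Lemma 3.5; proof of Theorem 3.10,
  (3.121)–(3.122) (p. 14) [NewmanTassionWu2017].
-/

noncomputable section

namespace Literature.Probability.Percolation

open MeasureTheory LatticeModels SimpleGraph Finset

namespace NTW17

variable {k : ℕ}

/-! ## Connectivity of a box all of whose lattice edges are open -/

/-- A lattice chain all of whose consecutive edges are open joins its ends inside any set containing
its vertices. [folklore] -/
private theorem openConnIn_of_adjChain {ω : BondConfig (slab 3 k)} {S : Set (slab 3 k)}
    {L : List (slab 3 k)} (hne : L ≠ []) (hch : L.IsChain (fun a b => (slabGraph 3 k).Adj a b))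
    (hS : ∀ x ∈ L, x ∈ S)
    (hopen : ∀ x ∈ L, ∀ y ∈ L, (slabGraph 3 k).Adj x y → s(x, y) ∈ ω) :
    ω ∈ openConnIn S (L.head hne) (L.getLast hne) := by
  obtain ⟨a, t, rfl⟩ := List.exists_cons_of_ne_nil hne
  have hch' : (a :: t).IsChain (fun x y => s(x, y) ∈ ω ∧ x ≠ y) :=
    hch.imp_of_mem_imp fun x y hx hy hxy => ⟨hopen x hx y hy hxy, hxy.ne⟩
  exact openConnIn_of_isChain a t hch' hS

/-- **If every lattice edge over a box is open, any two vertices over the box are joined inside it**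
(an `L`-shaped planar path at the height of the first vertex followed by a vertical segment).
[folklore] -/
private theorem openConnIn_of_box_open {a b c d : ℤ} {ω : BondConfig (slab 3 k)} {T : Set (ℤ × ℤ)}
    (hT : boxR a b c d ⊆ T)
    (hopen : ∀ x y : slab 3 k, (slabGraph 3 k).Adj x y → planar k x ∈ boxR a b c d →
      planar k y ∈ boxR a b c d → s(x, y) ∈ ω)
    {u v : slab 3 k} (hu : planar k u ∈ boxR a b c d) (hv : planar k v ∈ boxR a b c d) :
    ω ∈ openConnIn (slabLift k T) u v := by
  -- the planar L-path at height `ht u`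
  obtain ⟨l, hl, hlmem⟩ := exists_lpath_hv (planar k u) (planar k v)
  have hlbox : ∀ z ∈ l, z ∈ boxR a b c d := by
    intro z hz
    rw [mem_boxR_iff] at hu hv ⊢
    rcases (hlmem z).1 hz with ⟨h1, h2, h3⟩ | ⟨h1, h2, h3⟩
    · rw [min_def] at h2; rw [max_def] at h3; split_ifs at h2 h3 <;> omega
    · rw [min_def] at h2; rw [max_def] at h3; split_ifs at h2 h3 <;> omega
  have hX := liftH_spath (k := k) hl (ht u)
  set X := liftH k (ht u) l with hXdef
  have hXmem : ∀ x ∈ X, planar k x ∈ boxR a b c d := by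
    intro x hx
    rw [hXdef, mem_liftH_iff (ht_le u)] at hx
    exact hlbox _ hx.1
  have hXhead : X.head hX.ne_nil = u := by
    have := hX.head
    rw [List.head?_eq_some_head hX.ne_nil, Option.some.injEq] at this
    rw [this, vtx_planar_ht]
  have hXlast : X.getLast hX.ne_nil = vtx k (planar k v) (ht u) := by
    have := hX.last
    rw [List.getLast?_eq_some_getLast hX.ne_nil, Option.some.injEq] at this
    exact this
  have h1 : ω ∈ openConnIn (slabLift k T) u (vtx k (planar k v) (ht u)) := by
    have := openConnIn_of_adjChain hX.ne_nil hX.chain (fun x hx => hT (hXmem x hx))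
      fun x hx y hy hxy => hopen x y hxy (hXmem x hx) (hXmem y hy)
    rwa [hXhead, hXlast] at this
  -- the vertical segment over `planar v`
  have hV := vline_spath (k := k) (planar k v) (ht_le u) (ht_le v)
  have hVmem : ∀ x ∈ vline k (planar k v) (ht u) (ht v), planar k x ∈ boxR a b c d := by
    intro x hx
    rw [mem_vline_iff (ht_le u) (ht_le v)] at hx
    rw [hx.1]; exact hv
  have hVhead : (vline k (planar k v) (ht u) (ht v)).head hV.ne_nil = vtx k (planar k v) (ht u) := by
    have := hV.head
    rw [List.head?_eq_some_head hV.ne_nil, Option.some.injEq] at this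
    exact this
  have hVlast : (vline k (planar k v) (ht u) (ht v)).getLast hV.ne_nil = v := by
    have := hV.last
    rw [List.getLast?_eq_some_getLast hV.ne_nil, Option.some.injEq] at this
    rw [this, vtx_planar_ht]
  have h2 : ω ∈ openConnIn (slabLift k T) (vtx k (planar k v) (ht u)) v := by
    have := openConnIn_of_adjChain hV.ne_nil hV.chain (fun x hx => hT (hVmem x hx))
      fun x hx y hy hxy => hopen x y hxy (hVmem x hx) (hVmem y hy)
    rwa [hVhead, hVlast] at this
  exact SlabCriticality.openConnIn_trans h1 h2

/-! ## The crude corner gluing -/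

section Crude

variable {dom cor A B C E : Set (ℤ × ℤ)} {a b c d : ℤ}

/-- **Finite-energy corner gluing.** Let `dom, cor` be finite planar regions, `Sq ⊆ dom` a box,
such that every open crossing of `dom̄` from `Ā` to `B̄` and every open crossing of `cor̄` from `C̄`
to `Ē` has a vertex over `Sq`. Then for every measurable bystander `G` determined by the edges over
a planar set disjoint from `Sq`,
`P_p[G ∩ (A ⟷^dom B) ∩ (C ⟷^cor E) ∖ (C ⟷^{dom ∪ cor} A)] ≤ λ^{(5k+4)|Sq|} · P_p[G ∩ (C ⟷^{dom ∪ cor} A)]`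
(open every lattice edge over `Sq`; Lemma 3.5 with the fixed window).
[cite: NewmanTassionWu2017, Theorem 3.10 (proof, (3.121)–(3.122)) with Lemma 3.5] -/
theorem real_cornerGlue_crude (p : unitInterval) (hp0 : 0 < (p : ℝ)) (hp1 : (p : ℝ) < 1)
    (hdom : dom.Finite) (hcor : cor.Finite) (hSd : boxR a b c d ⊆ dom)
    (SqF : Finset (ℤ × ℤ)) (hSqF : boxR a b c d ⊆ ↑SqF)
    (hγ : ∀ ω : BondConfig (slab 3 k), ω ⊆ (slabGraph 3 k).edgeSet → ∀ l,
      IsOSAP k ω (slabLift k dom) (slabLift k A) (slabLift k B) l → ∃ v ∈ l, planar k v ∈ boxR a b c d)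
    (hκ : ∀ ω : BondConfig (slab 3 k), ω ⊆ (slabGraph 3 k).edgeSet → ∀ l,
      IsOSAP k ω (slabLift k cor) (slabLift k C) (slabLift k E) l → ∃ v ∈ l, planar k v ∈ boxR a b c d)
    {Ω : Set (ℤ × ℤ)} (hΩ : Disjoint Ω (boxR a b c d)) {G : Set (BondConfig (slab 3 k))}
    (hG : DeterminedBy G (slabLift k Ω).sym2) (hGm : MeasurableSet G) :
    (bondPercolation (slabGraph 3 k) p).real
        (G ∩ (slabConn k dom A B ∩ slabConn k cor C E) ∩ (slabConn k (dom ∪ cor) C A)ᶜ) ≤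
      (2 / min (p : ℝ) (1 - p)) ^ ((5 * k + 4) * SqF.card) *
        (bondPercolation (slabGraph 3 k) p).real (G ∩ slabConn k (dom ∪ cor) C A) := by
  classical
  set P := bondPercolation (slabGraph 3 k) p with hP
  set Sq := boxR a b c d with hSq
  have hSqfin : Sq.Finite := boxR_finite a b c d
  set W : Finset (Sym2 (slab 3 k)) :=
    ((finite_sym2 (slabLift_finite k hSqfin)).toFinset).filter (· ∈ (slabGraph 3 k).edgeSet) with hW
  have hWmem : ∀ e, e ∈ W ↔ e ∈ (slabLift k Sq).sym2 ∧ e ∈ (slabGraph 3 k).edgeSet := by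
    intro e; rw [hW, Finset.mem_filter, Set.Finite.mem_toFinset]
  have hWE : ∀ e ∈ W, e ∈ (slabGraph 3 k).edgeSet := fun e he => ((hWmem e).1 he).2
  have hR : (dom ∪ cor).Finite := hdom.union hcor
  have hWR : ∀ e ∈ W, e ∈ (slabLift k (dom ∪ cor)).sym2 := fun e he =>
    sym2_mono (slabLift_mono k (hSd.trans Set.subset_union_left)) ((hWmem e).1 he).1
  have hWD : ∀ e ∈ W, e ∈ touch k Sq := by
    intro e he
    have h1 := ((hWmem e).1 he).1
    induction e using Sym2.ind with
    | h x y =>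
      rw [Set.mk_mem_sym2_iff] at h1
      exact mk_mem_touch_iff.2 (Or.inl h1.1)
  -- the window is small
  have hWcard : W.card ≤ (5 * k + 4) * SqF.card := by
    have hsub : W ⊆ W.filter (fun e => ∃ u ∈ e, planar k u ∈ SqF) := by
      intro e he
      rw [Finset.mem_filter]
      refine ⟨he, ?_⟩
      have h1 := ((hWmem e).1 he).1
      induction e using Sym2.ind with
      | h x y =>
        rw [Set.mk_mem_sym2_iff] at h1
        exact ⟨x, Sym2.mem_mk_left _ _, hSqF h1.1⟩
    exact (Finset.card_le_card hsub).trans (card_filter_colEdges_le k W hWE SqF)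
  -- determination
  have hX : DeterminedBy (slabConn k dom A B ∩ slabConn k cor C E ∩ (slabConn k (dom ∪ cor) C A)ᶜ)
      (slabLift k (dom ∪ cor)).sym2 :=
    ((determinedBy_slabConn k A B Set.subset_union_left).inter
      (determinedBy_slabConn k C E Set.subset_union_right)).inter
      (determinedBy_slabConn k C A subset_rfl).compl
  have hY : DeterminedBy (slabConn k (dom ∪ cor) C A) (slabLift k (dom ∪ cor)).sym2 :=
    determinedBy_slabConn k C A subset_rfl
  -- the map
  have hmap : ∀ ω : BondConfig (slab 3 k), ω ⊆ (slabGraph 3 k).edgeSet →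
      ω ∈ slabConn k dom A B ∩ slabConn k cor C E ∩ (slabConn k (dom ∪ cor) C A)ᶜ →
      ω ∪ ↑W ∈ slabConn k (dom ∪ cor) C A := by
    rintro ω hω ⟨⟨hAB, hCE⟩, -⟩
    rw [mem_slabConn_iff_exists_isOSAP] at hAB hCE
    obtain ⟨γ, hγ'⟩ := hAB
    obtain ⟨κ, hκ'⟩ := hCE
    obtain ⟨vγ, hvγ, hvγS⟩ := hγ ω hω γ hγ'
    obtain ⟨vκ, hvκ, hvκS⟩ := hκ ω hω κ hκ'
    have hsubω : ω ⊆ ω ∪ ↑W := Set.subset_union_left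
    -- `C̄ ∋ κ.head ⟷ vκ` inside `cor̄`
    have h1 : ω ∪ ↑W ∈ openConnIn (slabLift k (dom ∪ cor)) (κ.head hκ'.ne_nil) vκ :=
      openConnIn_mono_config hsubω
        (openConnIn_mono (slabLift_mono k Set.subset_union_right) _ _ (hκ'.openConnIn_of_mem hvκ))
    -- `vκ ⟷ vγ` inside the opened box
    have h2 : ω ∪ ↑W ∈ openConnIn (slabLift k (dom ∪ cor)) vκ vγ := by
      refine openConnIn_of_box_open (hSd.trans Set.subset_union_left) (fun x y hxy hx hy => ?_) hvκS hvγS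
      refine Or.inr ?_
      rw [Finset.mem_coe, hWmem]
      exact ⟨Set.mk_mem_sym2_iff.2 ⟨hx, hy⟩, (SimpleGraph.mem_edgeSet _).2 hxy⟩
    -- `vγ ⟷ γ.head ∈ Ā` inside `dom̄`
    have h3 : ω ∪ ↑W ∈ openConnIn (slabLift k (dom ∪ cor)) vγ (γ.head hγ'.ne_nil) :=
      openConnIn_reverse (openConnIn_mono_config hsubω
        (openConnIn_mono (slabLift_mono k Set.subset_union_left) _ _ (hγ'.openConnIn_of_mem hvγ)))
    exact ⟨κ.head hκ'.ne_nil, hκ'.head_mem _, γ.head hγ'.ne_nil, hγ'.head_mem _,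
      SlabCriticality.openConnIn_trans h1 (SlabCriticality.openConnIn_trans h2 h3)⟩
  have hbound := real_inter_le_of_fixedWindow_of_determinedBy p hp0 hp1 hR hX hY W hWE hWR hWD hΩ hG
    hGm hmap
  have hlam : 1 ≤ 2 / min (p : ℝ) (1 - p) := by
    rw [le_div_iff₀ (by positivity)]
    have := min_le_left (p : ℝ) (1 - p)
    linarith
  calc P.real (G ∩ (slabConn k dom A B ∩ slabConn k cor C E) ∩ (slabConn k (dom ∪ cor) C A)ᶜ)
      = P.real (G ∩ (slabConn k dom A B ∩ slabConn k cor C E ∩ (slabConn k (dom ∪ cor) C A)ᶜ)) := by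
        rw [Set.inter_assoc]
    _ ≤ (2 / min (p : ℝ) (1 - p)) ^ W.card * P.real (G ∩ slabConn k (dom ∪ cor) C A) := hbound
    _ ≤ (2 / min (p : ℝ) (1 - p)) ^ ((5 * k + 4) * SqF.card) *
          P.real (G ∩ slabConn k (dom ∪ cor) C A) := by
        exact mul_le_mul_of_nonneg_right (pow_le_pow_right₀ hlam hWcard) measureReal_nonneg

end Crude

/-! ## The four corners -/

section Corners

variable (k) (N n : ℕ) (p : unitInterval)

/-- The corner square as a finite set of `n²` cells. [folklore] -/
private theorem exists_sqFinset (a c : ℤ) (n : ℕ) :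
    ∃ SqF : Finset (ℤ × ℤ), boxR a (a + n - 1) c (c + n - 1) ⊆ ↑SqF ∧ SqF.card ≤ n ^ 2 := by
  refine ⟨Finset.Icc a (a + n - 1) ×ˢ Finset.Icc c (c + n - 1), fun z hz => ?_, ?_⟩
  · rw [mem_boxR_iff] at hz
    simp only [Finset.coe_product, Finset.coe_Icc, Set.mem_prod, Set.mem_Icc]
    exact ⟨⟨hz.1, hz.2.1⟩, ⟨hz.2.2.1, hz.2.2.2⟩⟩
  · rw [Finset.card_product, Int.card_Icc, Int.card_Icc, sq]
    have : (a + n - 1 + 1 - a).toNat = n := by omega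
    have h' : (c + n - 1 + 1 - c).toNat = n := by omega
    rw [this, h']

variable {k N n}

/-- A crossing vertex at a prescribed level: an open path of a lattice configuration whose
coordinate functional `φ` starts below `t` and ends above `t` has a vertex with `φ = t`.
[cite: NewmanTassionWu2017, Theorem 3.10 (proof)] -/
private theorem exists_level_vertex {ω : BondConfig (slab 3 k)} (hω : ω ⊆ (slabGraph 3 k).edgeSet)
    {φ : ℤ × ℤ → ℤ} (hφ : ∀ z w, planarAdj z w → φ w ≤ φ z + 1) {t : ℤ} {l : List (slab 3 k)}
    (hne : l ≠ []) (hl : l.IsChain (fun a b => s(a, b) ∈ ω ∧ a ≠ b))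
    (hhead : φ (planar k (l.head hne)) < t) (hlast : t < φ (planar k (l.getLast hne))) :
    ∃ v ∈ l, φ (planar k v) = t := by
  obtain ⟨v, hv, -, hφv, -⟩ := exists_crossVertex (X := Set.univ) hω hφ le_rfl hne hl
    (fun _ _ _ _ => Set.mem_univ _) hhead hlast
  exact ⟨v, hv, hφv⟩

/-- The first coordinate is 1-Lipschitz along lattice steps. [folklore] -/
private theorem lipx : ∀ z w : ℤ × ℤ, planarAdj z w → (fun z : ℤ × ℤ => z.1) w ≤ (fun z : ℤ × ℤ => z.1) z + 1 :=
  fun z w h => by have := abs_sub_le_one_of_planarAdj h; simp only; omega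
/-- Minus the first coordinate is 1-Lipschitz along lattice steps. [folklore] -/
private theorem lipx' : ∀ z w : ℤ × ℤ, planarAdj z w → (fun z : ℤ × ℤ => -z.1) w ≤ (fun z : ℤ × ℤ => -z.1) z + 1 :=
  fun z w h => by have := abs_sub_le_one_of_planarAdj h; simp only; omega
/-- The second coordinate is 1-Lipschitz along lattice steps. [folklore] -/
private theorem lipy : ∀ z w : ℤ × ℤ, planarAdj z w → (fun z : ℤ × ℤ => z.2) w ≤ (fun z : ℤ × ℤ => z.2) z + 1 :=
  fun z w h => by have := abs_sub_le_one_of_planarAdj h; simp only; omega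
/-- Minus the second coordinate is 1-Lipschitz along lattice steps. [folklore] -/
private theorem lipy' : ∀ z w : ℤ × ℤ, planarAdj z w → (fun z : ℤ × ℤ => -z.2) w ≤ (fun z : ℤ × ℤ => -z.2) z + 1 :=
  fun z w h => by have := abs_sub_le_one_of_planarAdj h; simp only; omega

/-- The exponent is monotone: `λ ≥ 1`. [folklore] -/
private theorem lam_ge_one (hp0 : 0 < (p : ℝ)) (hp1 : (p : ℝ) < 1) : 1 ≤ 2 / min (p : ℝ) (1 - p) := by
  rw [le_div_iff₀ (by positivity)]
  have := min_le_left (p : ℝ) (1 - p)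
  have := p.2.2
  linarith

/-- **`CornerGlue₁ k N n p λ_p^{(5k+4)n²}` for every `N ≥ 1` and every `n`** (finite energy in the
top-right corner square). [cite: NewmanTassionWu2017, Theorem 3.10 (proof, (3.121)–(3.122)) with Lemma 3.5] -/
theorem cornerGlue₁_crude (hp0 : 0 < (p : ℝ)) (hp1 : (p : ℝ) < 1) (hN : 1 ≤ N) :
    CornerGlue₁ k N n p ((2 / min (p : ℝ) (1 - p)) ^ ((5 * k + 4) * n ^ 2)) := by
  intro Ω G hΩ hG hGm
  obtain ⟨SqF, hSqF, hcard⟩ := exists_sqFinset ((N : ℤ) + 1) ((N : ℤ) + 1) n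
  have hSq : cornerSq N n 0 = boxR ((N : ℤ) + 1) ((N : ℤ) + n) ((N : ℤ) + 1) ((N : ℤ) + n) := by
    simp [cornerSq]
  have hSq' : boxR ((N : ℤ) + 1) ((N : ℤ) + 1 + n - 1) ((N : ℤ) + 1) ((N : ℤ) + 1 + n - 1) =
      boxR ((N : ℤ) + 1) ((N : ℤ) + n) ((N : ℤ) + 1) ((N : ℤ) + n) := by
    have : (N : ℤ) + 1 + n - 1 = N + n := by ring
    rw [this]
  rw [hSq'] at hSqF
  rw [hSq] at hΩ
  have hSd : boxR ((N : ℤ) + 1) ((N : ℤ) + n) ((N : ℤ) + 1) ((N : ℤ) + n) ⊆ domT N n := by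
    intro z hz; simp only [domT, mem_boxR_iff] at hz ⊢; omega
  have h := real_cornerGlue_crude (k := k) (cor := corR N n) (A := {z | z.1 = -(N : ℤ)}) (B := {z | z.1 = (N : ℤ) + n + 1})
    (C := {z | z.2 = -(N : ℤ)}) (E := {z | z.2 = (N : ℤ) + n}) p hp0 hp1
    (boxR_finite _ _ _ _) (boxR_finite _ _ _ _) hSd SqF hSqF ?_ ?_ hΩ hG hGm
  · exact h.trans (mul_le_mul_of_nonneg_right
      (pow_le_pow_right₀ (lam_ge_one p hp0 hp1) (Nat.mul_le_mul_left _ hcard)) measureReal_nonneg)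
  · -- `Γ_T` passes the column `x = N + n` inside the rows of the corner square
    intro ω hω l hl
    have hhead : (planar k (l.head hl.ne_nil)).1 < (N : ℤ) + n := by
      have := hl.head_mem hl.ne_nil; simp only [mem_slabLift_iff, Set.mem_setOf_eq] at this; omega
    have hlast : (N : ℤ) + n < (planar k (l.getLast hl.ne_nil)).1 := by
      have := hl.last_mem hl.ne_nil; simp only [mem_slabLift_iff, Set.mem_setOf_eq] at this; omega
    obtain ⟨v, hv, hφ⟩ := exists_level_vertex hω lipx hl.ne_nil hl.chain hhead hlast
    refine ⟨v, hv, ?_⟩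
    have := hl.subset v hv
    simp only [mem_slabLift_iff, mem_boxR_iff] at this hφ ⊢
    omega
  · -- `κ_R` ends on the top row of the corner square
    intro ω hω l hl
    refine ⟨l.getLast hl.ne_nil, List.getLast_mem _, ?_⟩
    have h1 := hl.last_mem hl.ne_nil
    have h2 := hl.subset _ (List.getLast_mem hl.ne_nil)
    simp only [mem_slabLift_iff, Set.mem_setOf_eq, corR, mem_boxR_iff] at h1 h2 ⊢
    omega

/-- **`CornerGlue₂ k N n p λ_p^{(5k+4)n²}`** (bottom-right corner). [cite: NewmanTassionWu2017, Theorem 3.10 (proof, (3.121)–(3.122)) with Lemma 3.5] -/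
theorem cornerGlue₂_crude (hp0 : 0 < (p : ℝ)) (hp1 : (p : ℝ) < 1) (hN : 1 ≤ N) :
    CornerGlue₂ k N n p ((2 / min (p : ℝ) (1 - p)) ^ ((5 * k + 4) * n ^ 2)) := by
  intro Ω G hΩ hG hGm
  obtain ⟨SqF, hSqF, hcard⟩ := exists_sqFinset ((N : ℤ) + 1) (-((N : ℤ) + n)) n
  have hSq : cornerSq N n 1 = boxR ((N : ℤ) + 1) ((N : ℤ) + n) (-((N : ℤ) + n)) (-((N : ℤ) + 1)) := by
    simp [cornerSq]
  have hSq' : boxR ((N : ℤ) + 1) ((N : ℤ) + 1 + n - 1) (-((N : ℤ) + n)) (-((N : ℤ) + n) + n - 1) =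
      boxR ((N : ℤ) + 1) ((N : ℤ) + n) (-((N : ℤ) + n)) (-((N : ℤ) + 1)) := by
    have h1 : (N : ℤ) + 1 + n - 1 = N + n := by ring
    have h2 : -((N : ℤ) + n) + n - 1 = -((N : ℤ) + 1) := by ring
    rw [h1, h2]
  rw [hSq'] at hSqF
  rw [hSq] at hΩ
  have hSd : boxR ((N : ℤ) + 1) ((N : ℤ) + n) (-((N : ℤ) + n)) (-((N : ℤ) + 1)) ⊆ domR N n := by
    intro z hz; simp only [domR, mem_boxR_iff] at hz ⊢; omega
  have h := real_cornerGlue_crude (k := k) (cor := corB N n) (A := {z | z.2 = (N : ℤ)}) (B := {z | z.2 = -((N : ℤ) + n + 1)})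
    (C := {z | z.1 = -(N : ℤ)}) (E := {z | z.1 = (N : ℤ) + n}) p hp0 hp1
    (boxR_finite _ _ _ _) (boxR_finite _ _ _ _) hSd SqF hSqF ?_ ?_ hΩ hG hGm
  · exact h.trans (mul_le_mul_of_nonneg_right
      (pow_le_pow_right₀ (lam_ge_one p hp0 hp1) (Nat.mul_le_mul_left _ hcard)) measureReal_nonneg)
  · -- `Γ_R` passes the row `y = -(N+n)` inside the columns of the corner square
    intro ω hω l hl
    have hhead : -(planar k (l.head hl.ne_nil)).2 < (N : ℤ) + n := by
      have := hl.head_mem hl.ne_nil; simp only [mem_slabLift_iff, Set.mem_setOf_eq] at this; omega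
    have hlast : (N : ℤ) + n < -(planar k (l.getLast hl.ne_nil)).2 := by
      have := hl.last_mem hl.ne_nil; simp only [mem_slabLift_iff, Set.mem_setOf_eq] at this; omega
    obtain ⟨v, hv, hφ⟩ := exists_level_vertex hω lipy' hl.ne_nil hl.chain hhead hlast
    refine ⟨v, hv, ?_⟩
    have := hl.subset v hv
    simp only [mem_slabLift_iff, mem_boxR_iff] at this hφ ⊢
    omega
  · intro ω hω l hl
    refine ⟨l.getLast hl.ne_nil, List.getLast_mem _, ?_⟩
    have h1 := hl.last_mem hl.ne_nil
    have h2 := hl.subset _ (List.getLast_mem hl.ne_nil)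
    simp only [mem_slabLift_iff, Set.mem_setOf_eq, corB, mem_boxR_iff] at h1 h2 ⊢
    omega

/-- **`CornerGlue₃ k N n p λ_p^{(5k+4)n²}`** (bottom-left corner). [cite: NewmanTassionWu2017, Theorem 3.10 (proof, (3.121)–(3.122)) with Lemma 3.5] -/
theorem cornerGlue₃_crude (hp0 : 0 < (p : ℝ)) (hp1 : (p : ℝ) < 1) (hN : 1 ≤ N) :
    CornerGlue₃ k N n p ((2 / min (p : ℝ) (1 - p)) ^ ((5 * k + 4) * n ^ 2)) := by
  intro Ω G hΩ hG hGm
  obtain ⟨SqF, hSqF, hcard⟩ := exists_sqFinset (-((N : ℤ) + n)) (-((N : ℤ) + n)) n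
  have hSq : cornerSq N n 2 = boxR (-((N : ℤ) + n)) (-((N : ℤ) + 1)) (-((N : ℤ) + n)) (-((N : ℤ) + 1)) := by
    simp [cornerSq]
  have hSq' : boxR (-((N : ℤ) + n)) (-((N : ℤ) + n) + n - 1) (-((N : ℤ) + n)) (-((N : ℤ) + n) + n - 1) =
      boxR (-((N : ℤ) + n)) (-((N : ℤ) + 1)) (-((N : ℤ) + n)) (-((N : ℤ) + 1)) := by
    have h2 : -((N : ℤ) + n) + n - 1 = -((N : ℤ) + 1) := by ring
    rw [h2]
  rw [hSq'] at hSqF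
  rw [hSq] at hΩ
  have hSd : boxR (-((N : ℤ) + n)) (-((N : ℤ) + 1)) (-((N : ℤ) + n)) (-((N : ℤ) + 1)) ⊆ domB N n := by
    intro z hz; simp only [domB, mem_boxR_iff] at hz ⊢; omega
  have h := real_cornerGlue_crude (k := k) (cor := corL N n) (A := {z | z.1 = (N : ℤ)}) (B := {z | z.1 = -((N : ℤ) + n + 1)})
    (C := {z | z.2 = (N : ℤ)}) (E := {z | z.2 = -((N : ℤ) + n)}) p hp0 hp1
    (boxR_finite _ _ _ _) (boxR_finite _ _ _ _) hSd SqF hSqF ?_ ?_ hΩ hG hGm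
  · exact h.trans (mul_le_mul_of_nonneg_right
      (pow_le_pow_right₀ (lam_ge_one p hp0 hp1) (Nat.mul_le_mul_left _ hcard)) measureReal_nonneg)
  · intro ω hω l hl
    have hhead : -(planar k (l.head hl.ne_nil)).1 < (N : ℤ) + n := by
      have := hl.head_mem hl.ne_nil; simp only [mem_slabLift_iff, Set.mem_setOf_eq] at this; omega
    have hlast : (N : ℤ) + n < -(planar k (l.getLast hl.ne_nil)).1 := by
      have := hl.last_mem hl.ne_nil; simp only [mem_slabLift_iff, Set.mem_setOf_eq] at this; omega
    obtain ⟨v, hv, hφ⟩ := exists_level_vertex hω lipx' hl.ne_nil hl.chain hhead hlast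
    refine ⟨v, hv, ?_⟩
    have := hl.subset v hv
    simp only [mem_slabLift_iff, mem_boxR_iff] at this hφ ⊢
    omega
  · intro ω hω l hl
    refine ⟨l.getLast hl.ne_nil, List.getLast_mem _, ?_⟩
    have h1 := hl.last_mem hl.ne_nil
    have h2 := hl.subset _ (List.getLast_mem hl.ne_nil)
    simp only [mem_slabLift_iff, Set.mem_setOf_eq, corL, mem_boxR_iff] at h1 h2 ⊢
    omega

/-- **`CornerGlue₄ k N n p λ_p^{(5k+4)n²}`** (top-left corner). [cite: NewmanTassionWu2017, Theorem 3.10 (proof, (3.121)–(3.122)) with Lemma 3.5] -/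
theorem cornerGlue₄_crude (hp0 : 0 < (p : ℝ)) (hp1 : (p : ℝ) < 1) (hN : 1 ≤ N) :
    CornerGlue₄ k N n p ((2 / min (p : ℝ) (1 - p)) ^ ((5 * k + 4) * n ^ 2)) := by
  intro Ω G hΩ hG hGm
  obtain ⟨SqF, hSqF, hcard⟩ := exists_sqFinset (-((N : ℤ) + n)) ((N : ℤ) + 1) n
  have hSq : cornerSq N n 3 = boxR (-((N : ℤ) + n)) (-((N : ℤ) + 1)) ((N : ℤ) + 1) ((N : ℤ) + n) := by
    simp [cornerSq]
  have hSq' : boxR (-((N : ℤ) + n)) (-((N : ℤ) + n) + n - 1) ((N : ℤ) + 1) ((N : ℤ) + 1 + n - 1) =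
      boxR (-((N : ℤ) + n)) (-((N : ℤ) + 1)) ((N : ℤ) + 1) ((N : ℤ) + n) := by
    have h1 : (N : ℤ) + 1 + n - 1 = N + n := by ring
    have h2 : -((N : ℤ) + n) + n - 1 = -((N : ℤ) + 1) := by ring
    rw [h1, h2]
  rw [hSq'] at hSqF
  rw [hSq] at hΩ
  have hSd : boxR (-((N : ℤ) + n)) (-((N : ℤ) + 1)) ((N : ℤ) + 1) ((N : ℤ) + n) ⊆ domL N n := by
    intro z hz; simp only [domL, mem_boxR_iff] at hz ⊢; omega
  have h := real_cornerGlue_crude (k := k) (cor := corT N n) (A := {z | z.2 = -(N : ℤ)}) (B := {z | z.2 = (N : ℤ) + n + 1})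
    (C := {z | z.1 = (N : ℤ)}) (E := {z | z.1 = -((N : ℤ) + n)}) p hp0 hp1
    (boxR_finite _ _ _ _) (boxR_finite _ _ _ _) hSd SqF hSqF ?_ ?_ hΩ hG hGm
  · exact h.trans (mul_le_mul_of_nonneg_right
      (pow_le_pow_right₀ (lam_ge_one p hp0 hp1) (Nat.mul_le_mul_left _ hcard)) measureReal_nonneg)
  · intro ω hω l hl
    have hhead : (planar k (l.head hl.ne_nil)).2 < (N : ℤ) + n := by
      have := hl.head_mem hl.ne_nil; simp only [mem_slabLift_iff, Set.mem_setOf_eq] at this; omega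
    have hlast : (N : ℤ) + n < (planar k (l.getLast hl.ne_nil)).2 := by
      have := hl.last_mem hl.ne_nil; simp only [mem_slabLift_iff, Set.mem_setOf_eq] at this; omega
    obtain ⟨v, hv, hφ⟩ := exists_level_vertex hω lipy hl.ne_nil hl.chain hhead hlast
    refine ⟨v, hv, ?_⟩
    have := hl.subset v hv
    simp only [mem_slabLift_iff, mem_boxR_iff] at this hφ ⊢
    omega
  · intro ω hω l hl
    refine ⟨l.getLast hl.ne_nil, List.getLast_mem _, ?_⟩
    have h1 := hl.last_mem hl.ne_nil
    have h2 := hl.subset _ (List.getLast_mem hl.ne_nil)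
    simp only [mem_slabLift_iff, Set.mem_setOf_eq, corT, mem_boxR_iff] at h1 h2 ⊢
    omega

end Corners

end NTW17

end Literature.Probability.Percolation

end
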